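import Summits.Ventures.Crystal3D.Theorems.StickyWulffConstantTextureLiminfTexShadowFccResidualSort
import Summits.Ventures.Crystal3D.Theorems.StickyWulffConstantGenericWallFloorPayerPoolThick
import Summits.Ventures.Crystal3D.Theorems.StickyWulffConstantTextureLiminfBilayerWallBookkeeping
import Summits.Ventures.Crystal3D.Theorems.StickyWulffConstantTextureLiminfTexShadowCoaxialCharge
import Summits.Ventures.Crystal3D.Theorems.StickyWulffConstantGenericWallFloorOfCore
import HarnessLib

/-!
# TexShadow — the PER-PAIR closers for `BothFcc` plate pairs of the (β) kind, classes (β-i) UNREGISTERED and (β-ii)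
# RAY-SEPARATED: lane G's uniform payer-pool export ⇒ `BilayerWallAt` (lane T, crux `TextureLiminf`, stmt-Ventures-19483;
# line `TexShadow` v6.17 → v6.18; cf-p1 22:45:22Z (g2), DECISION (xlv⁗) R1)

HONEST FRAMING. Venture `Summits/Ventures/Crystal3D` (cell `crystal3d-full`), helper `--supports` the crux `TextureLiminf`
(stmt-Ventures-19483) of `route-Ventures-StickyWulffConstant`, registered line `TexShadow`.  Rung credit only; F-C1 not moved.
Pure proofs, standard axioms, no new definitions.  Inputs BY NAME exactly as lane G's payer pools: `ExactOnly`(C12-55) [E1] at a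
slot star `s₀`, `DoubleStarCoaxialAt`, `CapPairCoaxial` [from `StarPairFar`, computational grade].

(g2) = the T-side half of the (β) branch (non-co-axial `BothFcc` pairs).  Lane G's G-U export (19480-p2 g9) is the PAYER-POOL
inequality `(√2|⟪F₁u₁,e₃⟫| + √2|⟪F₂u₂,e₃⟫|)·πρ² − 4000·(1 + h + 2(R₀−10))·ρ ≤ Σ_{PAY}(12 − deg)` for affine fcc plates at every
thickness `R₀ ≥ 10` (`payerPool_local_sep_thick` — separated frame families; `payerPool_offReach_thick` — disjoint reach sets),
UNIFORM in the pair; lane T consumes payer pools through `bilayerWallAt_of_payerBound` (wulff-p2 g13).  This file composes them: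
* `bilayerWallAt_of_pool_fcc` — abstract step: a payer pool `Φπρ² − K(1+h+D)ρ ≤ Σ_PAY` with `Φ ≥ 2` for the affine plates
  `(Fₖ· + tₖ) '' Λ₀ = stacking Lₖ sₖ σₖ` and a table `0 ≤ c ≤ 1` give `BilayerWallAt ((K(1+D) + 3456 + 1152(R₀+1))/2) R₀ …`
  (`2Q ≤ 2πρ²` by `tsum_charge_le_cap`);
* **`bilayerWallAt_of_sep_fcc`** / **`bilayerWallAt_of_not_rayAligned_fcc`** — (β-ii): steep slots with SEPARATED chain families
  (resp. `¬RayAlignedAt F₁ F₂`, via `exists_separated_of_not_rayAlignedAt`) ⇒ the cell inequality at every `R₀ ≥ 10` with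
  `C = (4000(1 + 2(R₀−10)) + 3456 + 1152(R₀+1))/2`;
* **`bilayerWallAt_of_not_registered_fcc`** — (β-i): `¬RegisteredAt F₁ t₁ F₂ t₂` ⇒ the same;
* **`bilayerWallAt_of_not_coAx_offSigma9`** — the T-keyed form: a `BothFcc` pair with `¬CoAx P₁ P₂`, bilayer frames, an admissible
  table, `hgen` at the frame pair `(0,0)` and OUTSIDE the six `Σ9` cells and `SeparatedWide` (the (β-iii) classes that wait for
  L-2, cf-p1 22:31:11Z) satisfies the cell inequality — by `priced_alternatives_of_not_coAx` (…FccResidualSort) and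
  `bilayerFrame_affine_eq` (the plates ARE the affine lattices of their bilayer frames `(Aₖ 0, uₖ 0)`).
Constants explicit and pair-free ⇒ these are R1-uniform in T's `∀ R₀ ≥ R, ∃ C, ∀ pairs` shape (R = 10).
WHAT THIS IS NOT: not (β-iii) (six `Σ9` cells + `SeparatedWide`), not the (α) co-axial branch (…FccCoaxialPair + F-U), not the
v6.18 stub plumbing; F-C1 not moved.
-/

noncomputable section

open scoped BigOperators InnerProductSpace ENNReal
open MeasureTheory

namespace Summit.Ventures.Crystal3D.Theorems

open Summit.Ventures.Crystal3D Finset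
open Literature.MathematicalPhysics.StatisticalMechanics (fccStacking barlowStacking IsHaggSeq)
open Summit.Ventures.Crystal3D.Cruxes.TextureLiminf.TexShadow (E3 e₃ fccRef stacking laySlab cyl CoAx BilayerFramesAt
  BilayerChargeAdmissible InResidualClass BilayerWallAt)

open scoped Classical in
/-- **Payer pool ⇒ cell inequality, for affine fcc plates.**  If `stacking Lₖ sₖ σₖ = (Fₖ· + tₖ) '' Λ₀` (`k = 1, 2`), the table
satisfies `0 ≤ c ≤ 1`, and in every clamped cell of thickness `R₀ ≥ 3` a payer pool `Φ·π·ρ² − K·(1 + (h + D))·ρ ≤ Σ_{PAY}(12 − deg)`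
holds with `Φ ≥ 2`, `K, D ≥ 0`, then `BilayerWallAt ((K(1+D) + 3456 + 1152(R₀+1))/2) R₀ σ₁ σ₂ L₁ L₂ s₁ s₂ c`. -/
theorem bilayerWallAt_of_pool_fcc {σ₁ σ₂ : ℤ → ℤ} (hσ₁ : IsHaggSeq σ₁) (hσ₂ : IsHaggSeq σ₂)
    (L₁ L₂ : E3 ≃ₗᵢ[ℝ] E3) (s₁ s₂ : E3) {F₁ F₂ : E3 ≃ₗᵢ[ℝ] E3} {t₁ t₂ : E3}
    (hS₁ : stacking L₁ s₁ σ₁ = (fun q => F₁ q + t₁) '' fccStacking 1 (Real.sqrt (2 / 3)))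
    (hS₂ : stacking L₂ s₂ σ₂ = (fun q => F₂ q + t₂) '' fccStacking 1 (Real.sqrt (2 / 3)))
    {c : ℤ → ℤ → ℝ} (hc0 : ∀ i j, 0 ≤ c i j) (hc1 : ∀ i j, c i j ≤ 1)
    {R₀ K D Φ : ℝ} (hR₀ : 3 ≤ R₀) (hK : 0 ≤ K) (hD : 0 ≤ D) (hΦ : 2 ≤ Φ)
    (hpool : ∀ h : ℝ, 0 ≤ h → ∀ ρ : ℝ, R₀ ≤ ρ → ∀ X P₁ P₂ : Finset E3,
      (∀ p ∈ X, ∀ q ∈ X, p ≠ q → 1 ≤ dist p q) → P₁ ⊆ X → P₂ ⊆ X \ P₁ →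
      (∀ p ∈ X, -(2 * R₀) ≤ p 2 ∧ p 2 ≤ h + 2 * R₀ ∧ p 0 ^ 2 + p 1 ^ 2 ≤ ρ ^ 2) →
      (∀ p, p ∈ P₁ ↔ (p ∈ (fun q => F₁ q + t₁) '' fccStacking 1 (Real.sqrt (2 / 3)) ∧
        -(2 * R₀) ≤ p 2 ∧ p 2 ≤ -R₀ ∧ p 0 ^ 2 + p 1 ^ 2 ≤ ρ ^ 2)) →
      (∀ p, p ∈ P₂ ↔ (p ∈ (fun q => F₂ q + t₂) '' fccStacking 1 (Real.sqrt (2 / 3)) ∧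
        h + R₀ ≤ p 2 ∧ p 2 ≤ h + 2 * R₀ ∧ p 0 ^ 2 + p 1 ^ 2 ≤ ρ ^ 2)) →
      Φ * Real.pi * ρ ^ 2 - K * (1 + (h + D)) * ρ ≤
        ∑ y ∈ X.filter (fun y => (X.filter fun q => dist y q = 1).card ≠ 12 ∧ -R₀ - 2 ≤ y 2 ∧ y 2 ≤ h + R₀ + 2),
          ((12 : ℝ) - ((X.filter fun q => dist y q = 1).card : ℝ))) :
    BilayerWallAt ((K * (1 + D) + 3456 + 1152 * (R₀ + 1)) / 2) R₀ σ₁ σ₂ L₁ L₂ s₁ s₂ c := by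
  refine bilayerWallAt_of_payerBound hσ₁ hσ₂ L₁ L₂ s₁ s₂ R₀ (K * (1 + D)) hR₀ c ?_
  intro h hh ρ hρ X P₁ P₂ hX hP₁X hP₂X hcyl hP₁ hP₂
  have hρ0 : 0 ≤ ρ := by linarith
  have hP₁' : ∀ p, p ∈ P₁ ↔ (p ∈ (fun q => F₁ q + t₁) '' fccStacking 1 (Real.sqrt (2 / 3)) ∧
      -(2 * R₀) ≤ p 2 ∧ p 2 ≤ -R₀ ∧ p 0 ^ 2 + p 1 ^ 2 ≤ ρ ^ 2) := fun p => by rw [← hS₁]; exact hP₁ p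
  have hP₂' : ∀ p, p ∈ P₂ ↔ (p ∈ (fun q => F₂ q + t₂) '' fccStacking 1 (Real.sqrt (2 / 3)) ∧
      h + R₀ ≤ p 2 ∧ p 2 ≤ h + 2 * R₀ ∧ p 0 ^ 2 + p 1 ^ 2 ≤ ρ ^ 2) := fun p => by rw [← hS₂]; exact hP₂ p
  have pool := hpool h hh ρ hρ X P₁ P₂ hX hP₁X hP₂X (fun p hp => hcyl p hp) hP₁' hP₂'
  have cap := tsum_charge_le_cap L₁ L₂ s₁ s₂ c zero_le_one hc0 hc1 hρ0
  have hslice : (wallSlice ρ : Set E3) = {q : E3 | 0 ≤ q 2 ∧ q 2 ≤ 1 ∧ q 0 ^ 2 + q 1 ^ 2 ≤ ρ ^ 2} := rfl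
  rw [hslice] at cap
  have hπ : 0 ≤ Real.pi * ρ ^ 2 := by positivity
  have herr : K * (1 + (h + D)) * ρ ≤ K * (1 + D) * (1 + h) * ρ := by
    have h1 : 1 + (h + D) ≤ (1 + D) * (1 + h) := by nlinarith
    have h2 : K * (1 + (h + D)) ≤ K * (1 + D) * (1 + h) := by nlinarith
    exact mul_le_mul_of_nonneg_right h2 hρ0
  nlinarith [pool, cap, herr, hπ, hΦ]

open scoped Classical in
/-- **(β-ii) SEPARATED chain families ⇒ the cell inequality**, for affine fcc plates, at every thickness `R₀ ≥ 10`. -/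
theorem bilayerWallAt_of_sep_fcc
    {s₀ : E3} (hs₀ : s₀ ∈ fccSlots) (hcert : ExactOnly 0 (fccSlots.filter fun w => 0 < ⟪w, s₀⟫_ℝ))
    (hDS : ∀ G₁ G₂ : E3 ≃ₗᵢ[ℝ] E3, DoubleStarCoaxialAt G₁ G₂) (hCP : CapPairCoaxial)
    {σ₁ σ₂ : ℤ → ℤ} (hσ₁ : IsHaggSeq σ₁) (hσ₂ : IsHaggSeq σ₂)
    (L₁ L₂ : E3 ≃ₗᵢ[ℝ] E3) (s₁ s₂ : E3) {F₁ F₂ : E3 ≃ₗᵢ[ℝ] E3} {t₁ t₂ : E3}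
    (hS₁ : stacking L₁ s₁ σ₁ = (fun q => F₁ q + t₁) '' fccStacking 1 (Real.sqrt (2 / 3)))
    (hS₂ : stacking L₂ s₂ σ₂ = (fun q => F₂ q + t₂) '' fccStacking 1 (Real.sqrt (2 / 3)))
    {c : ℤ → ℤ → ℝ} (hc0 : ∀ i j, 0 ≤ c i j) (hc1 : ∀ i j, c i j ≤ 1)
    {u₁ : E3} (hu₁ : u₁ ∈ fccSlots) (hsteep₁ : Real.sqrt 2 / 2 ≤ ⟪F₁ u₁, EuclideanSpace.single (2 : Fin 3) (1 : ℝ)⟫_ℝ)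
    {u₂ : E3} (hu₂ : u₂ ∈ fccSlots) (hsteep₂ : ⟪F₂ u₂, EuclideanSpace.single (2 : Fin 3) (1 : ℝ)⟫_ℝ ≤ -(Real.sqrt 2 / 2))
    (hsep : ∀ G₁ ∈ chainFrames (EuclideanSpace.single (2 : Fin 3) (1 : ℝ)) F₁ u₁,
      ∀ G₂ ∈ chainFrames (-EuclideanSpace.single (2 : Fin 3) (1 : ℝ)) F₂ u₂,
      ¬ ∃ (L : E3 ≃ₗᵢ[ℝ] E3) (r₁ r₂ : E3) (σ σ' : ℤ → ℤ), IsHaggSeq σ ∧ IsHaggSeq σ' ∧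
        G₁ '' fccStacking 1 (Real.sqrt (2 / 3)) ⊆ (fun p => L p + r₁) '' barlowStacking 1 (Real.sqrt (2 / 3)) σ ∧
        G₂ '' fccStacking 1 (Real.sqrt (2 / 3)) ⊆ (fun p => L p + r₂) '' barlowStacking 1 (Real.sqrt (2 / 3)) σ')
    {R₀ : ℝ} (hR₀ : 10 ≤ R₀) :
    BilayerWallAt ((2 * 2000 * (1 + 2 * (R₀ - 10)) + 3456 + 1152 * (R₀ + 1)) / 2) R₀ σ₁ σ₂ L₁ L₂ s₁ s₂ c := by
  have hs2 : Real.sqrt 2 * (Real.sqrt 2 / 2) = 1 := by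
    have h := Real.mul_self_sqrt (show (0 : ℝ) ≤ 2 by norm_num); linarith
  have hΦ : 2 ≤ Real.sqrt 2 * |⟪F₁ u₁, EuclideanSpace.single (2 : Fin 3) (1 : ℝ)⟫_ℝ| +
      Real.sqrt 2 * |⟪F₂ u₂, EuclideanSpace.single (2 : Fin 3) (1 : ℝ)⟫_ℝ| := by
    have h1 : Real.sqrt 2 / 2 ≤ |⟪F₁ u₁, EuclideanSpace.single (2 : Fin 3) (1 : ℝ)⟫_ℝ| :=
      hsteep₁.trans (le_abs_self _)
    have h2 : Real.sqrt 2 / 2 ≤ |⟪F₂ u₂, EuclideanSpace.single (2 : Fin 3) (1 : ℝ)⟫_ℝ| := by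
      have := neg_le_abs ⟪F₂ u₂, EuclideanSpace.single (2 : Fin 3) (1 : ℝ)⟫_ℝ; linarith
    have hs : 0 ≤ Real.sqrt 2 := Real.sqrt_nonneg _
    nlinarith [mul_le_mul_of_nonneg_left h1 hs, mul_le_mul_of_nonneg_left h2 hs]
  refine bilayerWallAt_of_pool_fcc hσ₁ hσ₂ L₁ L₂ s₁ s₂ hS₁ hS₂ hc0 hc1 (by linarith) (by norm_num) (by linarith) hΦ ?_
  intro h hh ρ hρ X P₁ P₂ hX hP₁X hP₂X hcell hP₁ hP₂
  exact payerPool_local_sep_thick hs₀ hcert hDS hCP F₁ F₂ hu₁ hsteep₁ hu₂ hsteep₂ _ _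
    (fun _ hS hW hlast => frame_mem_chainFrames_of_stack hS hW hlast)
    (fun _ hS hW hlast => frame_mem_chainFrames_of_stack hS hW hlast) hsep hR₀ t₁ t₂ h hh ρ hρ X P₁ P₂
    hX hP₁X hP₂X hcell hP₁ hP₂

open scoped Classical in
/-- **(β-ii) RAY-SEPARATED (`¬RayAlignedAt`) ⇒ the cell inequality**, for affine fcc plates, at every thickness `R₀ ≥ 10`. -/
theorem bilayerWallAt_of_not_rayAligned_fcc
    {s₀ : E3} (hs₀ : s₀ ∈ fccSlots) (hcert : ExactOnly 0 (fccSlots.filter fun w => 0 < ⟪w, s₀⟫_ℝ))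
    (hDS : ∀ G₁ G₂ : E3 ≃ₗᵢ[ℝ] E3, DoubleStarCoaxialAt G₁ G₂) (hCP : CapPairCoaxial)
    {σ₁ σ₂ : ℤ → ℤ} (hσ₁ : IsHaggSeq σ₁) (hσ₂ : IsHaggSeq σ₂)
    (L₁ L₂ : E3 ≃ₗᵢ[ℝ] E3) (s₁ s₂ : E3) {F₁ F₂ : E3 ≃ₗᵢ[ℝ] E3} {t₁ t₂ : E3}
    (hS₁ : stacking L₁ s₁ σ₁ = (fun q => F₁ q + t₁) '' fccStacking 1 (Real.sqrt (2 / 3)))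
    (hS₂ : stacking L₂ s₂ σ₂ = (fun q => F₂ q + t₂) '' fccStacking 1 (Real.sqrt (2 / 3)))
    {c : ℤ → ℤ → ℝ} (hc0 : ∀ i j, 0 ≤ c i j) (hc1 : ∀ i j, c i j ≤ 1) (hra : ¬ RayAlignedAt F₁ F₂)
    {R₀ : ℝ} (hR₀ : 10 ≤ R₀) :
    BilayerWallAt ((2 * 2000 * (1 + 2 * (R₀ - 10)) + 3456 + 1152 * (R₀ + 1)) / 2) R₀ σ₁ σ₂ L₁ L₂ s₁ s₂ c := by
  obtain ⟨u₁, hu₁, hst₁, u₂, hu₂, hst₂, hsep⟩ := exists_separated_of_not_rayAlignedAt hra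
  exact bilayerWallAt_of_sep_fcc hs₀ hcert hDS hCP hσ₁ hσ₂ L₁ L₂ s₁ s₂ hS₁ hS₂ hc0 hc1 hu₁ hst₁ hu₂ hst₂ hsep hR₀

open scoped Classical in
/-- **(β-i) UNREGISTERED (`¬RegisteredAt`) ⇒ the cell inequality**, for affine fcc plates, at every thickness `R₀ ≥ 10`. -/
theorem bilayerWallAt_of_not_registered_fcc
    {s₀ : E3} (hs₀ : s₀ ∈ fccSlots) (hcert : ExactOnly 0 (fccSlots.filter fun w => 0 < ⟪w, s₀⟫_ℝ))
    (hDS : ∀ G₁ G₂ : E3 ≃ₗᵢ[ℝ] E3, DoubleStarCoaxialAt G₁ G₂) (hCP : CapPairCoaxial)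
    {σ₁ σ₂ : ℤ → ℤ} (hσ₁ : IsHaggSeq σ₁) (hσ₂ : IsHaggSeq σ₂)
    (L₁ L₂ : E3 ≃ₗᵢ[ℝ] E3) (s₁ s₂ : E3) {F₁ F₂ : E3 ≃ₗᵢ[ℝ] E3} {t₁ t₂ : E3}
    (hS₁ : stacking L₁ s₁ σ₁ = (fun q => F₁ q + t₁) '' fccStacking 1 (Real.sqrt (2 / 3)))
    (hS₂ : stacking L₂ s₂ σ₂ = (fun q => F₂ q + t₂) '' fccStacking 1 (Real.sqrt (2 / 3)))
    {c : ℤ → ℤ → ℝ} (hc0 : ∀ i j, 0 ≤ c i j) (hc1 : ∀ i j, c i j ≤ 1) (hreg : ¬ RegisteredAt F₁ t₁ F₂ t₂)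
    {R₀ : ℝ} (hR₀ : 10 ≤ R₀) :
    BilayerWallAt ((2 * 2000 * (1 + 2 * (R₀ - 10)) + 3456 + 1152 * (R₀ + 1)) / 2) R₀ σ₁ σ₂ L₁ L₂ s₁ s₂ c := by
  unfold RegisteredAt at hreg
  push Not at hreg
  obtain ⟨u₁, hu₁, hsteep₁, u₂, hu₂, hsteep₂, hdisj⟩ := hreg
  have hs2 : Real.sqrt 2 * (Real.sqrt 2 / 2) = 1 := by
    have h := Real.mul_self_sqrt (show (0 : ℝ) ≤ 2 by norm_num); linarith
  have hΦ : 2 ≤ Real.sqrt 2 * |⟪F₁ u₁, EuclideanSpace.single (2 : Fin 3) (1 : ℝ)⟫_ℝ| +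
      Real.sqrt 2 * |⟪F₂ u₂, EuclideanSpace.single (2 : Fin 3) (1 : ℝ)⟫_ℝ| := by
    have h1 : Real.sqrt 2 / 2 ≤ |⟪F₁ u₁, EuclideanSpace.single (2 : Fin 3) (1 : ℝ)⟫_ℝ| :=
      hsteep₁.trans (le_abs_self _)
    have h2 : Real.sqrt 2 / 2 ≤ |⟪F₂ u₂, EuclideanSpace.single (2 : Fin 3) (1 : ℝ)⟫_ℝ| := by
      have := neg_le_abs ⟪F₂ u₂, EuclideanSpace.single (2 : Fin 3) (1 : ℝ)⟫_ℝ; linarith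
    have hs : 0 ≤ Real.sqrt 2 := Real.sqrt_nonneg _
    nlinarith [mul_le_mul_of_nonneg_left h1 hs, mul_le_mul_of_nonneg_left h2 hs]
  refine bilayerWallAt_of_pool_fcc hσ₁ hσ₂ L₁ L₂ s₁ s₂ hS₁ hS₂ hc0 hc1 (by linarith) (by norm_num) (by linarith) hΦ ?_
  intro h hh ρ hρ X P₁ P₂ hX hP₁X hP₂X hcell hP₁ hP₂
  exact payerPool_offReach_thick hs₀ hcert hDS hCP F₁ t₁ F₂ t₂ hu₁ hsteep₁ hu₂ hsteep₂ _ _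
    (fun _ hS hW hlast => frame_mem_chainFrames_of_stack hS hW hlast)
    (fun _ hS hW hlast => frame_mem_chainFrames_of_stack hS hW hlast)
    (fun y hy₁ hy₂ => hdisj y hy₁ hy₂) hR₀ h hh ρ hρ X P₁ P₂ hX hP₁X hP₂X hcell hP₁ hP₂

open scoped Classical in
/-- **The T-keyed (β) closer outside the `Σ9`/separated-wide cells.**  A `BothFcc` pair (affine plate lattices `(Pₖ· + sₖ) '' Λ₀`)
with NON-co-axial linear lattices, bilayer frames, an admissible table, `hgen : ¬InResidualClass` at the frame pair `(0, 0)`, and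
outside the six `Σ9` cells and the separated-wide cell (on that frame pair) satisfies the cell inequality at every `R₀ ≥ 10`. -/
theorem bilayerWallAt_of_not_coAx_offSigma9
    {s₀ : E3} (hs₀ : s₀ ∈ fccSlots) (hcert : ExactOnly 0 (fccSlots.filter fun w => 0 < ⟪w, s₀⟫_ℝ))
    (hDS : ∀ G₁ G₂ : E3 ≃ₗᵢ[ℝ] E3, DoubleStarCoaxialAt G₁ G₂) (hCP : CapPairCoaxial)
    {σ₁ σ₂ : ℤ → ℤ} (hσ₁ : IsHaggSeq σ₁) (hσ₂ : IsHaggSeq σ₂)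
    {L₁ L₂ P₁ P₂ : E3 ≃ₗᵢ[ℝ] E3} {s₁ s₂ : E3}
    (hS₁ : stacking L₁ s₁ σ₁ = (fun q => P₁ q + s₁) '' fccStacking 1 (Real.sqrt (2 / 3)))
    (hS₂ : stacking L₂ s₂ σ₂ = (fun q => P₂ q + s₂) '' fccStacking 1 (Real.sqrt (2 / 3)))
    {A₁ A₂ : ℤ → (E3 ≃ₗᵢ[ℝ] E3)} {u₁ u₂ : ℤ → E3}
    (hfr₁ : BilayerFramesAt L₁ s₁ σ₁ A₁ u₁) (hfr₂ : BilayerFramesAt L₂ s₂ σ₂ A₂ u₂)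
    {c : ℤ → ℤ → ℝ} {m : ℤ → ℤ → E3} (hadm : BilayerChargeAdmissible A₁ A₂ c m) (hnc : ¬ CoAx P₁ P₂)
    (hgen : ¬ InResidualClass (A₁ 0) (A₂ 0) (u₁ 0) (u₂ 0))
    (hβ : ¬ Sigma9OneSidedAt (A₁ 0) (A₂ 0) ∧ ¬ Sigma9OneSidedDownAt (A₁ 0) (A₂ 0) ∧ ¬ Sigma9TiltAt (A₁ 0) (A₂ 0) ∧
      ¬ Sigma9TiltDownAt (A₁ 0) (A₂ 0) ∧ ¬ Sigma9WideAt (A₁ 0) (A₂ 0) ∧ ¬ Sigma9WideDownAt (A₁ 0) (A₂ 0) ∧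
      ¬ SeparatedWideAt (A₁ 0) (A₂ 0))
    {R₀ : ℝ} (hR₀ : 10 ≤ R₀) :
    BilayerWallAt ((2 * 2000 * (1 + 2 * (R₀ - 10)) + 3456 + 1152 * (R₀ + 1)) / 2) R₀ σ₁ σ₂ L₁ L₂ s₁ s₂ c := by
  -- the plates are the affine lattices of their `0`-th bilayer frames
  have hS₁' : stacking L₁ s₁ σ₁ = (fun q => A₁ 0 q + u₁ 0) '' fccStacking 1 (Real.sqrt (2 / 3)) := by
    rw [hS₁, bilayerFrame_affine_eq hσ₁ hS₁ hfr₁ 0]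
  have hS₂' : stacking L₂ s₂ σ₂ = (fun q => A₂ 0 q + u₂ 0) '' fccStacking 1 (Real.sqrt (2 / 3)) := by
    rw [hS₂, bilayerFrame_affine_eq hσ₂ hS₂ hfr₂ 0]
  obtain ⟨h1, h2, h3, h4, h5, h6, h7⟩ := hβ
  rcases priced_alternatives_of_not_coAx hσ₁ hσ₂ hS₁ hS₂ hfr₁ hfr₂ hnc hgen with
    hra | h | h | h | h | h | h | h | hreg
  · exact bilayerWallAt_of_not_rayAligned_fcc hs₀ hcert hDS hCP hσ₁ hσ₂ L₁ L₂ s₁ s₂ hS₁' hS₂' hadm.1 hadm.2.1 hra hR₀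
  · exact absurd h h1
  · exact absurd h h2
  · exact absurd h h3
  · exact absurd h h4
  · exact absurd h h5
  · exact absurd h h6
  · exact absurd h h7
  · exact bilayerWallAt_of_not_registered_fcc hs₀ hcert hDS hCP hσ₁ hσ₂ L₁ L₂ s₁ s₂ hS₁' hS₂' hadm.1 hadm.2.1 hreg hR₀

end Summit.Ventures.Crystal3D.Theorems

end
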